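import Literature.Geometry.Manifold.ClarkeJacobianSemicontinuity
import Literature.Geometry.Manifold.ChartInverseFunctionTheorem
import Literature.Geometry.Manifold.PatchSystem
import HarnessLib

/-!
# Lipschitz / Clarke-regular homeomorphisms read in framed charts; two topological lemmas

Topic `Geometry/Manifold`; namespace `Literature.Geometry.Manifold`. Fifth proof layer under the
named fact `Literature.Geometry.Manifold.KondoTanakaRecognition` (Kondo–Tanaka 2017, Cor. 1.10),
for manifolds with the trivial model `𝓘(ℝ, E)`:

* `LipschitzOnWith.congr_set_eqOn` — bookkeeping;
* `exists_lipschitzOnWith_comp_extChartAt_symm` — if `h : M → N` is locally Lipschitz in charts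
  (`LocallyLipschitzInCharts`) and `e : N → V` is `C^∞`, then `e ∘ h ∘ φ_z⁻¹` is Lipschitz near
  `φ_z z` for every `z` (K–T §2.2: "The Lipschitz map `F` is therefore a map from `M` into `ℝᵐ`");
* `isCompact_clarkeJacobian_framedChart`, `isInvertible_of_mem_clarkeJacobian_framedChart` —
  **chart independence of Clarke regularity** (K–T §2.2, "the notion of the singular point of a
  Lipschitz map is independent of the choice of the Riemannian metric" / of local charts): if `h`
  has no Clarke-singular point in the preferred charts (`ClarkeRegularInCharts`), then for ANY
  framed chart `κ ∋ q₀` of `M` the generalised Jacobian of `ψ ∘ h ∘ κ⁻¹` at `κ q₀`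
  (`ψ = extChartAt (h q₀)`) is compact and consists of invertible maps (right chain rule through
  the transition map to the recentred preferred chart);
* `surjective_of_injective_of_isOpenMap` — a continuous injective open self-map of a compact
  Hausdorff locally connected space is surjective (it permutes the finitely many components; this
  replaces the covering-space Lemma 2.26 of K–T in the surjectivity half);
* `exists_pos_forall_dist_lt` — a Lebesgue-number lemma: for a continuous injection `F` of a
  compact space into a metric space and a finite open cover `W`, pairs with `F`-images closer than
  some `λ > 0` lie in a common `W i` (used for the injectivity half of Cor. 1.10);
* `exists_cthickening_subset_forall_lt` — near a compact set on which a continuous function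
  vanishes, it is uniformly small.

Everything here is proved; no definitions, no named facts.

## References

* K. Kondo, M. Tanaka, *Approximations of Lipschitz maps via immersions and differentiable exotic
  sphere theorems*, Nonlinear Anal. 155 (2017) 219–249 (arXiv:1408.6036), §2.2 and §2.3.
  [KondoTanaka2017]
-/

noncomputable section

open scoped Manifold ContDiff Topology NNReal
open Set Function Filter Metric

namespace Literature.Geometry.Manifold

/-! ### Bookkeeping -/

section Bookkeeping

variable {α : Type*} [PseudoEMetricSpace α] {β : Type*} [PseudoEMetricSpace β]

/-- A map which agrees on `s` with a map Lipschitz on a superset of `s` is Lipschitz on `s`.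
[folklore] -/
theorem _root_.LipschitzOnWith.congr_set_eqOn {K : ℝ≥0} {f g : α → β} {s t : Set α}
    (hf : LipschitzOnWith K f t) (hst : s ⊆ t) (hfg : EqOn f g s) : LipschitzOnWith K g s := by
  intro x hx y hy
  rw [← hfg hx, ← hfg hy]
  exact hf (hst hx) (hst hy)

end Bookkeeping

/-! ### Lipschitz data of `e ∘ h` in charts -/

section LipschitzData

variable {E : Type*} [NormedAddCommGroup E] [NormedSpace ℝ E]
  {M : Type*} [TopologicalSpace M] [ChartedSpace E M]
  {N : Type*} [TopologicalSpace N] [ChartedSpace E N]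
  {V : Type*} [NormedAddCommGroup V] [NormedSpace ℝ V]

/-- **`e ∘ h` is Lipschitz in charts**: for `h : M → N` continuous and locally Lipschitz in the
preferred charts and `e : N → V` of class `C^∞`, the chart expression `e ∘ h ∘ φ_z⁻¹` is Lipschitz
on a neighbourhood of `φ_z z` (compose the Lipschitz expression `ψ ∘ h ∘ φ_z⁻¹` with the `C¹`,
hence locally Lipschitz, expression `e ∘ ψ⁻¹`). [cite: KondoTanaka2017, §2.2] -/
theorem exists_lipschitzOnWith_comp_extChartAt_symm [IsManifold 𝓘(ℝ, E) ∞ N] {h : M → N}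
    (hcont : Continuous h) (hL : LocallyLipschitzInCharts 𝓘(ℝ, E) 𝓘(ℝ, E) h) {e : N → V}
    (he : ContMDiff 𝓘(ℝ, E) 𝓘(ℝ, V) ∞ e) (z : M) :
    ∃ (L : ℝ≥0) (s : Set E), s ∈ 𝓝 (extChartAt 𝓘(ℝ, E) z z) ∧
      LipschitzOnWith L ((e ∘ h) ∘ (extChartAt 𝓘(ℝ, E) z).symm) s := by
  set φ := extChartAt 𝓘(ℝ, E) z with hφ
  set ψ := extChartAt 𝓘(ℝ, E) (h z) with hψ
  set w : E → E := writtenInExtChartAt 𝓘(ℝ, E) 𝓘(ℝ, E) z h with hw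
  obtain ⟨L₁, s₁, hs₁, hlip₁⟩ := hL z
  -- `e ∘ ψ⁻¹` is `C^∞` on the target of `ψ`, hence Lipschitz near `ψ (h z)`
  have hcd' : ContDiffOn ℝ ∞ (e ∘ ψ.symm) ψ.target :=
    contMDiffOn_iff_contDiffOn.1 (he.comp_contMDiffOn (contMDiffOn_extChartAt_symm (h z)))
  have hcd : ContDiffAt ℝ 1 (e ∘ ψ.symm) (ψ (h z)) :=
    (hcd'.of_le (by simp)).contDiffAt
      ((isOpen_extChartAt_target (h z)).mem_nhds (mem_extChartAt_target (h z)))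
  obtain ⟨L₂, t, ht, hlip₂⟩ := hcd.exists_lipschitzOnWith
  -- continuity of the written map at `φ z`
  have hwz : w (φ z) = ψ (h z) := by
    simp [hw, writtenInExtChartAt, hφ, hψ]
  have hwc : ContinuousAt w (φ z) := by
    have h1 : ContinuousAt φ.symm (φ z) := continuousAt_extChartAt_symm z
    have h2 : ContinuousAt h (φ.symm (φ z)) := by
      rw [extChartAt_to_inv]; exact hcont.continuousAt
    have h3 : ContinuousAt ψ (h (φ.symm (φ z))) := by
      rw [extChartAt_to_inv]; exact continuousAt_extChartAt (h z)
    have h21 : ContinuousAt (h ∘ φ.symm) (φ z) := ContinuousAt.comp (f := φ.symm) (x := φ z) h2 h1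
    exact ContinuousAt.comp (f := h ∘ φ.symm) (x := φ z) h3 h21
  have hwt : w ⁻¹' t ∈ 𝓝 (φ z) := hwc.preimage_mem_nhds (by rwa [hwz])
  -- the set where `h ∘ φ⁻¹` lands in the source of `ψ`
  have hsrc : {u : E | h (φ.symm u) ∈ ψ.source} ∈ 𝓝 (φ z) := by
    have h1 : ContinuousAt (h ∘ φ.symm) (φ z) := by
      refine ContinuousAt.comp (f := φ.symm) (x := φ z) ?_ (continuousAt_extChartAt_symm z)
      rw [extChartAt_to_inv]; exact hcont.continuousAt
    refine h1.preimage_mem_nhds ((isOpen_extChartAt_source (h z)).mem_nhds ?_)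
    simp only [comp_apply, hφ, extChartAt_to_inv]
    exact mem_extChartAt_source (h z)
  refine ⟨L₂ * L₁, s₁ ∩ w ⁻¹' t ∩ {u : E | h (φ.symm u) ∈ ψ.source},
    inter_mem (inter_mem hs₁ hwt) hsrc, ?_⟩
  have hcomp : LipschitzOnWith (L₂ * L₁) ((e ∘ ψ.symm) ∘ w)
      (s₁ ∩ w ⁻¹' t ∩ {u : E | h (φ.symm u) ∈ ψ.source}) :=
    hlip₂.comp (hlip₁.mono (inter_subset_left.trans inter_subset_left))
      fun u hu => hu.1.2
  refine hcomp.congr_set_eqOn subset_rfl fun u hu => ?_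
  simp only [comp_apply, hw, writtenInExtChartAt]
  rw [ψ.left_inv hu.2]

end LipschitzData

/-! ### Chart independence of Clarke regularity -/

section RegularSet

variable {E : Type*} [NormedAddCommGroup E] [NormedSpace ℝ E]
  {M : Type*} [TopologicalSpace M] [ChartedSpace E M] [IsManifold 𝓘(ℝ, E) ∞ M]
  {N : Type*} [TopologicalSpace N] [ChartedSpace E N]

/-- **The generalised Jacobian in a framed chart is controlled by the one in the preferred
chart.** For `h : M → N` Lipschitz in the preferred charts near `q₀` and any framed chart `κ ∋ q₀`
of `M` (`ψ = extChartAt (h q₀)`): `ψ ∘ h ∘ κ⁻¹` is Lipschitz near `κ q₀`, and for some continuous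
linear equivalence `T` (the derivative at `0` of the transition map from the recentred preferred
chart to `κ`), `A ∘ T` lies in the generalised Jacobian of the preferred chart expression
`ψ ∘ h ∘ φ_{q₀}⁻¹` at `φ_{q₀} q₀` for every `A ∈ ∂(ψ ∘ h ∘ κ⁻¹)(κ q₀)`.
[cite: KondoTanaka2017, §2.2] -/
theorem clarkeJacobian_framedChart_comp_subset [CompleteSpace E] {h : M → N}
    (hL : LocallyLipschitzInCharts 𝓘(ℝ, E) 𝓘(ℝ, E) h) (κ : FramedChart 𝓘(ℝ, E) M E) {q₀ : M}
    (hq₀ : q₀ ∈ κ.source) :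
    (∃ (L : ℝ≥0) (s : Set E), s ∈ 𝓝 (κ.map q₀) ∧
      LipschitzOnWith L (extChartAt 𝓘(ℝ, E) (h q₀) ∘ h ∘ κ.inv) s) ∧
    ∃ T : E ≃L[ℝ] E, ∀ A ∈ clarkeJacobian (extChartAt 𝓘(ℝ, E) (h q₀) ∘ h ∘ κ.inv) (κ.map q₀),
      A.comp (T : E →L[ℝ] E) ∈
        clarkeJacobian (writtenInExtChartAt 𝓘(ℝ, E) 𝓘(ℝ, E) q₀ h) (extChartAt 𝓘(ℝ, E) q₀ q₀) := by
  set φ := extChartAt 𝓘(ℝ, E) q₀ with hφ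
  set ψ := extChartAt 𝓘(ℝ, E) (h q₀) with hψ
  set v₀ : E := φ q₀ with hv₀
  set u₀ : E := κ.map q₀ with hu₀
  set w : E → E := writtenInExtChartAt 𝓘(ℝ, E) 𝓘(ℝ, E) q₀ h with hw
  -- the recentred preferred chart as a framed chart
  set κ₀ : FramedChart 𝓘(ℝ, E) M E :=
    FramedChart.centred 𝓘(ℝ, E) (ContinuousLinearEquiv.refl ℝ E) q₀ with hκ₀
  have hq₀κ₀ : q₀ ∈ κ₀.source := mem_extChartAt_source q₀
  have hκ₀inv : ∀ y, κ₀.inv y = φ.symm (y + v₀) := fun y => by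
    simp [hκ₀, FramedChart.centred, FramedChart.inv_apply, hφ, hv₀]
  have hκ₀0 : κ₀.map q₀ = 0 := FramedChart.centred_map_base _ _
  have hg₀ : (ψ ∘ h ∘ κ₀.inv) = w ∘ fun y => y + v₀ := by
    funext y; simp [hw, writtenInExtChartAt, hκ₀inv, hψ, hφ]
  obtain ⟨L₁, s₁, hs₁, hlip₁⟩ := hL q₀
  -- the transition maps between `κ₀` and `κ`
  set τ : E → E := κ₀.transition κ with hτ
  set σ : E → E := κ.transition κ₀ with hσ
  have hO : IsOpen (κ₀.overlap κ) := κ₀.isOpen_overlap κ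
  have h0O : (0 : E) ∈ κ₀.overlap κ := by rw [← hκ₀0]; exact κ₀.map_mem_overlap κ hq₀κ₀ hq₀
  have hτ0 : τ 0 = u₀ := by
    rw [hτ, FramedChart.transition_apply, ← hκ₀0, κ₀.inv_map hq₀κ₀]
  have hO' : IsOpen (κ.overlap κ₀) := κ.isOpen_overlap κ₀
  have hu₀O : u₀ ∈ κ.overlap κ₀ := κ.map_mem_overlap κ₀ hq₀ hq₀κ₀
  have hτcd : ContDiffOn ℝ ∞ τ (κ₀.overlap κ) := κ₀.contDiffOn_transition κ
  have hσcd : ContDiffOn ℝ ∞ σ (κ.overlap κ₀) := κ.contDiffOn_transition κ₀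
  have hτd' : ∀ᶠ u in 𝓝 (0 : E), HasFDerivAt τ (fderiv ℝ τ u) u := by
    filter_upwards [hO.mem_nhds h0O] with u hu
    exact ((hτcd.contDiffAt (hO.mem_nhds hu)).differentiableAt (by simp)).hasFDerivAt
  have hτd : HasFDerivAt τ (fderiv ℝ τ 0) 0 := hτd'.self_of_nhds
  have hτ'c : ContinuousAt (fderiv ℝ τ) 0 :=
    (hτcd.continuousOn_fderiv_of_isOpen hO (by simp)).continuousAt (hO.mem_nhds h0O)
  have hσd : HasFDerivAt σ (fderiv ℝ σ (τ 0)) (τ 0) := by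
    rw [hτ0]
    exact ((hσcd.contDiffAt (hO'.mem_nhds hu₀O)).differentiableAt (by simp)).hasFDerivAt
  have hσc : ContinuousAt σ (τ 0) := by
    rw [hτ0]; exact (κ.continuousOn_transition κ₀).continuousAt (hO'.mem_nhds hu₀O)
  have hστ : σ (τ 0) = 0 := κ₀.transition_transition κ h0O
  have hστ' : ∀ᶠ z in 𝓝 (0 : E), σ (τ z) = z := by
    filter_upwards [hO.mem_nhds h0O] with z hz
    exact κ₀.transition_transition κ hz
  have hτσ : ∀ᶠ z in 𝓝 (τ 0), τ (σ z) = z := by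
    rw [hτ0]
    filter_upwards [hO'.mem_nhds hu₀O] with z hz
    exact κ.transition_transition κ₀ hz
  have hσu₀ : σ u₀ = 0 := by rw [← hτ0]; exact hστ
  refine ⟨?_, ?_⟩
  · -- Lipschitz of `ψ ∘ h ∘ κ⁻¹` near `u₀`: it is `(w ∘ (· + v₀)) ∘ σ` there
    have hloc' : ∀ᶠ u in 𝓝 u₀, (ψ ∘ h ∘ κ.inv) u = ((w ∘ fun y => y + v₀) ∘ σ) u := by
      rw [← hg₀]
      filter_upwards [hO'.mem_nhds hu₀O] with u hu
      simp only [comp_apply, hσ, κ.transition_eq_on_overlap κ₀ hu]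
    obtain ⟨A, hA, hAeq⟩ := hloc'.exists_mem
    have hσ1 : ContDiffAt ℝ 1 σ u₀ :=
      ((hσcd.contDiffAt (hO'.mem_nhds hu₀O)).of_le (by simp))
    obtain ⟨Kσ, tσ, htσ, hlipσ⟩ := hσ1.exists_lipschitzOnWith
    have hlipw : LipschitzOnWith (L₁ * 1) (w ∘ fun y => y + v₀) ((fun y => y + v₀) ⁻¹' s₁) :=
      hlip₁.comp ((IsometryEquiv.addRight v₀).isometry.lipschitz.lipschitzOnWith)
        (mapsTo_preimage _ _)
    have hpre : σ ⁻¹' ((fun y => y + v₀) ⁻¹' s₁) ∈ 𝓝 u₀ := by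
      refine (hτ0 ▸ hσc).preimage_mem_nhds ?_
      rw [hσu₀]
      exact ((continuous_id.add continuous_const).continuousAt (x := (0 : E))).preimage_mem_nhds
        (by simpa only [Pi.add_apply, id_eq, zero_add] using hs₁)
    set S : Set E := tσ ∩ σ ⁻¹' ((fun y => y + v₀) ⁻¹' s₁) ∩ A with hS
    have hSn : S ∈ 𝓝 u₀ := inter_mem (inter_mem htσ hpre) hA
    have hcomp : LipschitzOnWith (L₁ * 1 * Kσ) ((w ∘ fun y => y + v₀) ∘ σ)
        (tσ ∩ σ ⁻¹' ((fun y => y + v₀) ⁻¹' s₁)) :=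
      hlipw.comp (hlipσ.mono inter_subset_left) fun u hu => hu.2
    refine ⟨L₁ * 1 * Kσ, S, hSn, ?_⟩
    exact hcomp.congr_set_eqOn inter_subset_left fun u hu => (hAeq u hu.2).symm
  · -- the chain rule through the transition map
    obtain ⟨Tτ, hTτ⟩ := exists_equiv_of_hasFDerivAt_inverse hτd hσd hστ' hτσ
    refine ⟨Tτ, fun A hA => ?_⟩
    -- (a) `∂(ψ ∘ h ∘ κ₀⁻¹)(0) ⊆ ∂w(v₀)`
    have hJ₀ : clarkeJacobian (ψ ∘ h ∘ κ₀.inv) 0 ⊆ clarkeJacobian w v₀ := by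
      have hweq : w = (ψ ∘ h ∘ κ₀.inv) ∘ fun v => v - v₀ := by
        rw [hg₀]; funext v; simp
      have key := image_clarkeJacobian_comp_right_subset (g := ψ ∘ h ∘ κ₀.inv)
        (τ := fun v : E => v - v₀) (σ := fun y : E => y + v₀) (u₀ := v₀)
        (τ' := fun _ => ContinuousLinearMap.id ℝ E)
        (Eventually.of_forall fun v => (hasFDerivAt_id v).sub_const v₀) continuousAt_const
        (continuous_id.add continuous_const).continuousAt (by simp)
        (Eventually.of_forall fun z => by simp)
      rw [← hweq, sub_self] at key
      simpa only [ContinuousLinearMap.comp_id, image_id'] using key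
    -- (b) right chain rule through `τ`, and locality
    have hloc : (ψ ∘ h ∘ κ.inv) ∘ τ =ᶠ[𝓝 (0 : E)] (ψ ∘ h ∘ κ₀.inv) := by
      filter_upwards [hO.mem_nhds h0O] with y hy
      simp only [comp_apply, hτ, κ₀.transition_eq_on_overlap κ hy]
    have hchain := image_clarkeJacobian_comp_right_subset (g := ψ ∘ h ∘ κ.inv) hτd' hτ'c hσc hστ hτσ
    rw [clarkeJacobian_congr hloc, hτ0] at hchain
    rw [hTτ]
    exact hJ₀ (hchain ⟨A, hA, rfl⟩)

/-- **`∂(ψ ∘ h ∘ κ⁻¹)(κ q₀)` is compact** for `h` Lipschitz in charts and any framed chart `κ ∋ q₀`.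
[cite: KondoTanaka2017, §1.2] -/
theorem isCompact_clarkeJacobian_framedChart [FiniteDimensional ℝ E] {h : M → N}
    (hL : LocallyLipschitzInCharts 𝓘(ℝ, E) 𝓘(ℝ, E) h) (κ : FramedChart 𝓘(ℝ, E) M E) {q₀ : M}
    (hq₀ : q₀ ∈ κ.source) :
    IsCompact (clarkeJacobian (extChartAt 𝓘(ℝ, E) (h q₀) ∘ h ∘ κ.inv) (κ.map q₀)) := by
  haveI : CompleteSpace E := FiniteDimensional.complete ℝ E
  obtain ⟨⟨L, s, hs, hlip⟩, -⟩ := clarkeJacobian_framedChart_comp_subset hL κ hq₀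
  exact isCompact_clarkeJacobian hs hlip

/-- **Chart independence of Clarke regularity**: if `h` has no Clarke-singular point in the
preferred charts, every element of `∂(ψ ∘ h ∘ κ⁻¹)(κ q₀)` is invertible, for any framed chart
`κ ∋ q₀`. [cite: KondoTanaka2017, §2.2] -/
theorem isInvertible_of_mem_clarkeJacobian_framedChart [CompleteSpace E] {h : M → N}
    (hL : LocallyLipschitzInCharts 𝓘(ℝ, E) 𝓘(ℝ, E) h) (hR : ClarkeRegularInCharts 𝓘(ℝ, E) 𝓘(ℝ, E) h)
    (κ : FramedChart 𝓘(ℝ, E) M E) {q₀ : M} (hq₀ : q₀ ∈ κ.source) {A : E →L[ℝ] E}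
    (hA : A ∈ clarkeJacobian (extChartAt 𝓘(ℝ, E) (h q₀) ∘ h ∘ κ.inv) (κ.map q₀)) :
    A.IsInvertible := by
  obtain ⟨-, T, hT⟩ := clarkeJacobian_framedChart_comp_subset hL κ hq₀
  have hinv : (A.comp (T : E →L[ℝ] E)).IsInvertible := (hR q₀).2 _ (hT A hA)
  have heq : A = (A.comp (T : E →L[ℝ] E)).comp (T.symm : E →L[ℝ] E) := by
    ext v; simp
  rw [heq]
  exact hinv.comp ContinuousLinearMap.isInvertible_equiv

end RegularSet

/-! ### Two topological lemmas and a uniform estimate -/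

section Topology

/-- **A continuous injective open self-map of a compact Hausdorff locally connected space is
surjective**: it maps each connected component homeomorphically onto a connected component, so
it induces an injection of the finite set of components into itself, which is onto. [folklore] -/
theorem surjective_of_injective_of_isOpenMap {X : Type*} [TopologicalSpace X] [CompactSpace X]
    [T2Space X] [LocallyConnectedSpace X] {g : X → X} (hc : Continuous g) (hinj : Injective g)
    (hopen : IsOpenMap g) : Surjective g := by
  -- `g` maps components onto components
  have himg : ∀ x, g '' connectedComponent x = connectedComponent (g x) := by
    intro x
    refine Subset.antisymm
      ((isPreconnected_connectedComponent.image g hc.continuousOn).subset_connectedComponent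
        ⟨x, mem_connectedComponent, rfl⟩) ?_
    have hclopen : IsClopen (g '' connectedComponent x) :=
      ⟨(isClosed_connectedComponent.isCompact.image hc).isClosed,
        hopen _ isOpen_connectedComponent⟩
    exact isPreconnected_connectedComponent.subset_isClopen hclopen
      ⟨g x, mem_connectedComponent, x, mem_connectedComponent, rfl⟩
  -- the induced map on components is injective
  set G : ConnectedComponents X → ConnectedComponents X := hc.connectedComponentsMap with hG
  have hGinj : Injective G := by
    intro a b hab
    obtain ⟨x, rfl⟩ := ConnectedComponents.surjective_coe a
    obtain ⟨y, rfl⟩ := ConnectedComponents.surjective_coe b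
    have h1 : (ConnectedComponents.mk (g x) : ConnectedComponents X) = ConnectedComponents.mk (g y) := hab
    rw [ConnectedComponents.coe_eq_coe', ← himg y] at h1
    obtain ⟨z, hz, hzx⟩ := h1
    rw [← hinj hzx]
    exact ConnectedComponents.coe_eq_coe'.2 hz
  -- the space of components is finite
  haveI : DiscreteTopology (ConnectedComponents X) :=
    ConnectedComponents.discreteTopology_iff.2 fun x => isOpen_connectedComponent
  haveI : CompactSpace (ConnectedComponents X) := ⟨by
    rw [← range_eq_univ.2 ConnectedComponents.surjective_coe]
    exact isCompact_range ConnectedComponents.continuous_coe⟩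
  haveI : Finite (ConnectedComponents X) := finite_of_compact_of_discrete
  have hGsurj : Surjective G := Finite.surjective_of_injective hGinj
  intro y
  obtain ⟨a, ha⟩ := hGsurj (ConnectedComponents.mk y)
  obtain ⟨x, rfl⟩ := ConnectedComponents.surjective_coe a
  have h1 : (ConnectedComponents.mk (g x) : ConnectedComponents X) = ConnectedComponents.mk y := ha
  rw [ConnectedComponents.coe_eq_coe'] at h1
  have h2 : y ∈ connectedComponent (g x) := by
    rw [← connectedComponent_eq h1]; exact mem_connectedComponent
  rw [← himg x] at h2
  obtain ⟨z, -, hz⟩ := h2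
  exact ⟨z, hz⟩

/-- **A Lebesgue-number lemma for a continuous injection.** If `F : X → Y` is a continuous
injection of a compact space into a metric space and `W i` (`i` in a finite type) is an open
cover of `X`, there is `λ > 0` such that any two points whose images are `λ`-close lie in a common
`W i`. [folklore] -/
theorem exists_pos_forall_dist_lt {X : Type*} [TopologicalSpace X] [CompactSpace X] {Y : Type*}
    [MetricSpace Y] {F : X → Y} (hF : Continuous F) (hinj : Injective F) {ι : Type*}
    {W : ι → Set X} (hWo : ∀ i, IsOpen (W i)) (hWc : ∀ x, ∃ i, x ∈ W i) :
    ∃ lam > (0 : ℝ), ∀ a b : X, dist (F a) (F b) < lam → ∃ i, a ∈ W i ∧ b ∈ W i := by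
  classical
  set Kbad : Set (X × X) := {ab | ∀ i, ¬ (ab.1 ∈ W i ∧ ab.2 ∈ W i)} with hKbad
  have hclosed : IsClosed Kbad := by
    have heq : Kbad = (⋃ i, W i ×ˢ W i)ᶜ := by
      ext ab; simp [hKbad, mem_prod]
    rw [heq]
    exact (isOpen_iUnion fun i => (hWo i).prod (hWo i)).isClosed_compl
  have hcpt : IsCompact Kbad := hclosed.isCompact
  rcases Kbad.eq_empty_or_nonempty with hemp | hne
  · refine ⟨1, one_pos, fun a b _ => ?_⟩
    by_contra hno
    push Not at hno
    have : (a, b) ∈ Kbad := fun i hi => hno i hi.1 hi.2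
    rw [hemp] at this
    exact this
  -- the positive minimum of `dist (F a) (F b)` on the bad set
  have hdc : Continuous fun ab : X × X => dist (F ab.1) (F ab.2) :=
    (hF.comp continuous_fst).dist (hF.comp continuous_snd)
  obtain ⟨ab₀, hab₀, hmin⟩ := hcpt.exists_isMinOn hne hdc.continuousOn
  have hpos : 0 < dist (F ab₀.1) (F ab₀.2) := by
    rw [dist_pos]
    intro heq
    have hab : ab₀.1 = ab₀.2 := hinj heq
    obtain ⟨i, hi⟩ := hWc ab₀.1
    exact hab₀ i ⟨hi, hab ▸ hi⟩
  refine ⟨dist (F ab₀.1) (F ab₀.2), hpos, fun a b hab => ?_⟩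
  by_contra hno
  push Not at hno
  have hmem : (a, b) ∈ Kbad := fun i hi => hno i hi.1 hi.2
  exact absurd (hmin hmem) (not_le.2 hab)

/-- **Uniform smallness near a zero set.** If `Θ` is continuous on an open set `T` of a proper
metric space, non-negative there, and vanishes on a compact `K ⊆ T`, then for every `β > 0` some
closed `ϑ`-neighbourhood of `K` lies in `T` and `Θ < β` on it. [folklore] -/
theorem exists_cthickening_subset_forall_lt {Y : Type*} [MetricSpace Y] [ProperSpace Y]
    {T K : Set Y} (hT : IsOpen T) (hK : IsCompact K) (hKT : K ⊆ T) {Θ : Y → ℝ}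
    (hΘ : ContinuousOn Θ T) (hΘK : ∀ z ∈ K, Θ z = 0) {β : ℝ} (hβ : 0 < β) :
    ∃ ϑ > (0 : ℝ), cthickening ϑ K ⊆ T ∧ ∀ z ∈ cthickening ϑ K, Θ z < β := by
  have hU : IsOpen (T ∩ Θ ⁻¹' Iio β) := hΘ.isOpen_inter_preimage hT isOpen_Iio
  have hKU : K ⊆ T ∩ Θ ⁻¹' Iio β := fun z hz => ⟨hKT hz, by simp [hΘK z hz, hβ]⟩
  obtain ⟨ϑ, hϑ, hsub⟩ := hK.exists_cthickening_subset_open hU hKU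
  exact ⟨ϑ, hϑ, fun z hz => (hsub hz).1, fun z hz => (hsub hz).2⟩

end Topology

end Literature.Geometry.Manifold

end
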